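import Mathlib
import Summits.Ventures.PercRepro2.Defs
import Summits.Ventures.PercRepro2.CoinKStarLattice

/-!
# The black-box head over a PRODUCT core: the abstract lattice lemma (blind cell PercRepro2,
night-2 g7; proofs/NIGHT2-DARC.md §30)

S-frame form of row 2′DARC at a closed-out head (§30.1): with `W` the core cluster of the root,
`A(X) = P(X ↛ t through the entries and the head)` (the head's AVOIDANCE function, log-supermodular
by the reversed van den Berg–Kahn inequality) and `A_u(W) = A(W ∪ {w})` if `u ∈ W`, `A(W)`
otherwise,

  `P(R)² · Φ(E) = Λ² G_ab − Λ F̄_b G_a − Λ F̄_a G_b + F̄_a F̄_b G_∅`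

with `Λ = Σ_W β(W) A(W)`, `F̄_a = Σ_W β(W) A(W) x(W)`, `G_S = Σ_W β(W) A_u(W) (…)`, `β` the law of
the core cluster.  When the core is a STAR (independent coins `s → v`), `β` is a product measure on
the powerset of the core and the cluster is the configuration itself; splitting on `u ∈ W` writes
the four sums through THREE weights on the powerset of `C₀ = C ∖ {u}`:
`μ₀ = β₀ A(·)` (u absent), `μ₁ = β₀ A(· ∪ u)` (u present, `R`-cell), `μ' = β₀ A(· ∪ {u, w})`
(u present, gate cell).  `star_alg` is the pure ordered-field identity
`phiC · M₀ M' = q M' [Λ²(M₀ XY₀ − X₀ Y₀) + (Λ X₀ − F̄_a M₀)(Λ Y₀ − F̄_b M₀)]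
               + r M₀ [Λ²(M' XY' − X' Y') + (Λ X' − F̄_a M')(Λ Y' − F̄_b M')]`
whose brackets are FKG covariances and products of same-sign Holley shifts;
`starCore_functional_nonneg` derives the six inequalities from log-supermodularity of `A` and of
`β₀` via `fkg_powerset` / `holley_powerset`.  Nothing about coin systems is used here.
-/

namespace Summit.Ventures.PercRepro2.Coin

section StarAlg

variable {R : Type*} [Field R] [LinearOrder R] [IsStrictOrderedRing R]

/-- **The two-cell sign lemma of the star core.** With `Λ = q M₀ + r M₁`, `F̄_a = q X₀ + r X₁`,
`F̄_b = q Y₀ + r Y₁` (the `R`-quantities) and the gate quantities `q XY₀ + r XY'`, `q X₀ + r X'`,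
`q Y₀ + r Y'`, `q M₀ + r M'`, the cleared gate functional is nonnegative as soon as the two FKG
inequalities `X₀ Y₀ ≤ M₀ XY₀`, `X' Y' ≤ M' XY'` and the four Holley orderings
`m₀ ≤ m₁`, `m₁ ≤ m'`, `m₀ ≤ m'` (both markers) hold. -/
theorem star_alg (q r M₀ X₀ Y₀ XY₀ M₁ X₁ Y₁ M' X' Y' XY' : R)
    (hq : 0 ≤ q) (hr : 0 ≤ r) (hM₀ : 0 < M₀) (hM' : 0 < M')
    (hF₀ : X₀ * Y₀ ≤ M₀ * XY₀) (hF' : X' * Y' ≤ M' * XY')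
    (h01x : X₀ * M₁ ≤ M₀ * X₁) (h01y : Y₀ * M₁ ≤ M₀ * Y₁)
    (h1'x : X₁ * M' ≤ M₁ * X') (h1'y : Y₁ * M' ≤ M₁ * Y')
    (h0'x : X₀ * M' ≤ M₀ * X') (h0'y : Y₀ * M' ≤ M₀ * Y') :
    0 ≤ (q * M₀ + r * M₁) ^ 2 * (q * XY₀ + r * XY')
        - (q * M₀ + r * M₁) * (q * X₀ + r * X₁) * (q * Y₀ + r * Y')
        - (q * M₀ + r * M₁) * (q * Y₀ + r * Y₁) * (q * X₀ + r * X')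
        + (q * X₀ + r * X₁) * (q * Y₀ + r * Y₁) * (q * M₀ + r * M') := by
  set Λ := q * M₀ + r * M₁ with hΛ
  set Fa := q * X₀ + r * X₁ with hFa
  set Fb := q * Y₀ + r * Y₁ with hFb
  -- the exact identity
  have key : (Λ ^ 2 * (q * XY₀ + r * XY') - Λ * Fa * (q * Y₀ + r * Y')
      - Λ * Fb * (q * X₀ + r * X') + Fa * Fb * (q * M₀ + r * M')) * (M₀ * M') =
      q * M' * (Λ ^ 2 * (M₀ * XY₀ - X₀ * Y₀) + (Λ * X₀ - Fa * M₀) * (Λ * Y₀ - Fb * M₀))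
      + r * M₀ * (Λ ^ 2 * (M' * XY' - X' * Y') + (Λ * X' - Fa * M') * (Λ * Y' - Fb * M')) := by
    simp only [hΛ, hFa, hFb]; ring
  -- the shifts of the `u`-absent cell are ≤ 0
  have hs0x : Λ * X₀ - Fa * M₀ = r * (X₀ * M₁ - M₀ * X₁) := by simp only [hΛ, hFa]; ring
  have hs0y : Λ * Y₀ - Fb * M₀ = r * (Y₀ * M₁ - M₀ * Y₁) := by simp only [hΛ, hFb]; ring
  have hx0 : Λ * X₀ - Fa * M₀ ≤ 0 := by
    rw [hs0x]; exact mul_nonpos_of_nonneg_of_nonpos hr (by linarith)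
  have hy0 : Λ * Y₀ - Fb * M₀ ≤ 0 := by
    rw [hs0y]; exact mul_nonpos_of_nonneg_of_nonpos hr (by linarith)
  -- the shifts of the `u`-present gate cell are ≥ 0
  have hs'x : Λ * X' - Fa * M' = q * (M₀ * X' - X₀ * M') + r * (M₁ * X' - X₁ * M') := by
    simp only [hΛ, hFa]; ring
  have hs'y : Λ * Y' - Fb * M' = q * (M₀ * Y' - Y₀ * M') + r * (M₁ * Y' - Y₁ * M') := by
    simp only [hΛ, hFb]; ring
  have hx' : 0 ≤ Λ * X' - Fa * M' := by
    rw [hs'x]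
    exact add_nonneg (mul_nonneg hq (by linarith)) (mul_nonneg hr (by linarith))
  have hy' : 0 ≤ Λ * Y' - Fb * M' := by
    rw [hs'y]
    exact add_nonneg (mul_nonneg hq (by linarith)) (mul_nonneg hr (by linarith))
  have hP₀ : 0 ≤ Λ ^ 2 * (M₀ * XY₀ - X₀ * Y₀) + (Λ * X₀ - Fa * M₀) * (Λ * Y₀ - Fb * M₀) :=
    add_nonneg (mul_nonneg (sq_nonneg _) (by linarith)) (mul_nonneg_of_nonpos_of_nonpos hx0 hy0)
  have hP' : 0 ≤ Λ ^ 2 * (M' * XY' - X' * Y') + (Λ * X' - Fa * M') * (Λ * Y' - Fb * M') :=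
    add_nonneg (mul_nonneg (sq_nonneg _) (by linarith)) (mul_nonneg hx' hy')
  have hpos : 0 < M₀ * M' := mul_pos hM₀ hM'
  have hprod : 0 ≤ (Λ ^ 2 * (q * XY₀ + r * XY') - Λ * Fa * (q * Y₀ + r * Y')
      - Λ * Fb * (q * X₀ + r * X') + Fa * Fb * (q * M₀ + r * M')) * (M₀ * M') := by
    rw [key]
    exact add_nonneg (mul_nonneg (mul_nonneg hq hM'.le) hP₀) (mul_nonneg (mul_nonneg hr hM₀.le) hP')
  exact (mul_nonneg_iff_of_pos_right hpos).mp hprod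

end StarAlg

section StarLattice

open Classical

variable {V : Type*} [Fintype V] [DecidableEq V] {R : Type*} [Field R] [LinearOrder R]
  [IsStrictOrderedRing R]

/-- **The black-box head over a product core** (abstract form).  `C₀` is the core minus the tail
`u`; `β` a nonnegative log-supermodular weight on its powerset (the star core: the product law);
`A` a nonnegative log-supermodular function on the subsets of `C₀ ∪ {u, w}` (the head's avoidance
function, any head); `x, y` nonnegative increasing data (the markers `1[a ∈ W]`, `1[b ∈ W]`);
`q, r ≥ 0` the closed / open weights of the tail coin.  Then the cleared gate functional built from
`μ₀ = β A(·)`, `μ₁ = β A(· ∪ u)`, `μ' = β A(· ∪ {u, w})` is nonnegative. -/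
theorem starCore_functional_nonneg (C₀ : Finset V) (u w : V) (hu : u ∉ C₀) (hw : w ∉ C₀)
    (β A x y : Finset V → R) (q r : R) (hq : 0 ≤ q) (hr : 0 ≤ r)
    (hβ0 : ∀ L ⊆ C₀, 0 ≤ β L)
    (hβ : ∀ L L', L ⊆ C₀ → L' ⊆ C₀ → β L * β L' ≤ β (L ∩ L') * β (L ∪ L'))
    (hA0 : ∀ X ⊆ insert w (insert u C₀), 0 ≤ A X)
    (hA : ∀ X Y, X ⊆ insert w (insert u C₀) → Y ⊆ insert w (insert u C₀) →
      A X * A Y ≤ A (X ∩ Y) * A (X ∪ Y))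
    (hx0 : ∀ L ⊆ C₀, 0 ≤ x L) (hy0 : ∀ L ⊆ C₀, 0 ≤ y L)
    (hx : ∀ L L', L ⊆ L' → L' ⊆ C₀ → x L ≤ x L') (hy : ∀ L L', L ⊆ L' → L' ⊆ C₀ → y L ≤ y L')
    (hM₀ : 0 < ∑ L ∈ C₀.powerset, β L * A L)
    (hM' : 0 < ∑ L ∈ C₀.powerset, β L * A (insert w (insert u L))) :
    0 ≤ (q * ∑ L ∈ C₀.powerset, β L * A L + r * ∑ L ∈ C₀.powerset, β L * A (insert u L)) ^ 2
          * (q * ∑ L ∈ C₀.powerset, β L * A L * (x L * y L)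
            + r * ∑ L ∈ C₀.powerset, β L * A (insert w (insert u L)) * (x L * y L))
        - (q * ∑ L ∈ C₀.powerset, β L * A L + r * ∑ L ∈ C₀.powerset, β L * A (insert u L))
          * (q * ∑ L ∈ C₀.powerset, β L * A L * x L
            + r * ∑ L ∈ C₀.powerset, β L * A (insert u L) * x L)
          * (q * ∑ L ∈ C₀.powerset, β L * A L * y L
            + r * ∑ L ∈ C₀.powerset, β L * A (insert w (insert u L)) * y L)
        - (q * ∑ L ∈ C₀.powerset, β L * A L + r * ∑ L ∈ C₀.powerset, β L * A (insert u L))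
          * (q * ∑ L ∈ C₀.powerset, β L * A L * y L
            + r * ∑ L ∈ C₀.powerset, β L * A (insert u L) * y L)
          * (q * ∑ L ∈ C₀.powerset, β L * A L * x L
            + r * ∑ L ∈ C₀.powerset, β L * A (insert w (insert u L)) * x L)
        + (q * ∑ L ∈ C₀.powerset, β L * A L * x L
            + r * ∑ L ∈ C₀.powerset, β L * A (insert u L) * x L)
          * (q * ∑ L ∈ C₀.powerset, β L * A L * y L
            + r * ∑ L ∈ C₀.powerset, β L * A (insert u L) * y L)
          * (q * ∑ L ∈ C₀.powerset, β L * A L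
            + r * ∑ L ∈ C₀.powerset, β L * A (insert w (insert u L))) := by
  -- the three weights
  set μ₀ : Finset V → R := fun L => β L * A L with hμ₀
  set μ₁ : Finset V → R := fun L => β L * A (insert u L) with hμ₁
  set μ' : Finset V → R := fun L => β L * A (insert w (insert u L)) with hμ'
  have hsub : ∀ L ⊆ C₀, L ⊆ insert w (insert u C₀) := fun L hL =>
    hL.trans ((Finset.subset_insert _ _).trans (Finset.subset_insert _ _))
  have hsub₁ : ∀ L ⊆ C₀, insert u L ⊆ insert w (insert u C₀) := fun L hL =>
    (Finset.insert_subset_insert u hL).trans (Finset.subset_insert _ _)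
  have hsub' : ∀ L ⊆ C₀, insert w (insert u L) ⊆ insert w (insert u C₀) := fun L hL =>
    Finset.insert_subset_insert w (Finset.insert_subset_insert u hL)
  have hμ₀0 : ∀ L ⊆ C₀, 0 ≤ μ₀ L := fun L hL => mul_nonneg (hβ0 L hL) (hA0 L (hsub L hL))
  have hμ₁0 : ∀ L ⊆ C₀, 0 ≤ μ₁ L := fun L hL => mul_nonneg (hβ0 L hL) (hA0 _ (hsub₁ L hL))
  have hμ'0 : ∀ L ⊆ C₀, 0 ≤ μ' L := fun L hL => mul_nonneg (hβ0 L hL) (hA0 _ (hsub' L hL))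
  -- set identities (`u, w ∉ C₀`)
  have hiu : ∀ L L' : Finset V, L ⊆ C₀ → L ∩ insert u L' = L ∩ L' := by
    intro L L' hL
    exact Finset.inter_insert_of_notMem (fun h => hu (hL h))
  have huu : ∀ L L' : Finset V, L ∪ insert u L' = insert u (L ∪ L') := fun L L' =>
    Finset.union_insert u L L'
  have hiuw : ∀ L L' : Finset V, L ⊆ C₀ → L ∩ insert w (insert u L') = L ∩ L' := by
    intro L L' hL
    have hwL : w ∉ L := fun h => hw (hL h)
    have huL : u ∉ L := fun h => hu (hL h)
    ext z
    simp only [Finset.mem_inter, Finset.mem_insert]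
    constructor
    · rintro ⟨hz, hz'⟩
      refine ⟨hz, ?_⟩
      rcases hz' with rfl | rfl | h
      · exact absurd hz hwL
      · exact absurd hz huL
      · exact h
    · rintro ⟨hz, hz'⟩; exact ⟨hz, Or.inr (Or.inr hz')⟩
  have huuw : ∀ L L' : Finset V, L ∪ insert w (insert u L') = insert w (insert u (L ∪ L')) := by
    intro L L'; ext z
    simp only [Finset.mem_union, Finset.mem_insert]; tauto
  have hi1w : ∀ L L' : Finset V, L ⊆ C₀ →
      insert u L ∩ insert w (insert u L') = insert u (L ∩ L') := by
    intro L L' hL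
    have hwL : w ∉ L := fun h => hw (hL h)
    ext z
    simp only [Finset.mem_inter, Finset.mem_insert]
    constructor
    · rintro ⟨hz, hz'⟩
      rcases hz with rfl | hz
      · exact Or.inl rfl
      · rcases hz' with rfl | rfl | h
        · exact absurd hz hwL
        · exact Or.inl rfl
        · exact Or.inr ⟨hz, h⟩
    · rintro (rfl | ⟨hz, hz'⟩)
      · exact ⟨Or.inl rfl, Or.inr (Or.inl rfl)⟩
      · exact ⟨Or.inr hz, Or.inr (Or.inr hz')⟩
  have hu1w : ∀ L L' : Finset V, insert u L ∪ insert w (insert u L') = insert w (insert u (L ∪ L')) := by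
    intro L L'; ext z
    simp only [Finset.mem_union, Finset.mem_insert]; tauto
  have hiww : ∀ L L' : Finset V,
      insert w (insert u L) ∩ insert w (insert u L') = insert w (insert u (L ∩ L')) := by
    intro L L'; ext z
    simp only [Finset.mem_inter, Finset.mem_insert]; tauto
  have huww : ∀ L L' : Finset V,
      insert w (insert u L) ∪ insert w (insert u L') = insert w (insert u (L ∪ L')) := by
    intro L L'; ext z
    simp only [Finset.mem_union, Finset.mem_insert]; tauto
  -- the general product step: lsm of `β` times lsm of `A` at the shifted sets
  have hstep : ∀ (f g : Finset V → Finset V) (L L' : Finset V), L ⊆ C₀ → L' ⊆ C₀ →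
      f L ⊆ insert w (insert u C₀) → g L' ⊆ insert w (insert u C₀) →
      f L ∩ g L' = f (L ∩ L') → f L ∪ g L' = g (L ∪ L') →
      β L * A (f L) * (β L' * A (g L')) ≤
        β (L ∩ L') * A (f (L ∩ L')) * (β (L ∪ L') * A (g (L ∪ L'))) := by
    intro f g L L' hL hL' hf hg hi hun
    have h1 := hβ L L' hL hL'
    have h2 := hA (f L) (g L') hf hg
    rw [hi, hun] at h2
    calc β L * A (f L) * (β L' * A (g L')) = (β L * β L') * (A (f L) * A (g L')) := by ring
      _ ≤ (β (L ∩ L') * β (L ∪ L')) * (A (f (L ∩ L')) * A (g (L ∪ L'))) := by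
          apply mul_le_mul h1 h2
          · exact mul_nonneg (hA0 _ hf) (hA0 _ hg)
          · exact mul_nonneg (hβ0 _ (Finset.inter_subset_left.trans hL))
              (hβ0 _ (Finset.union_subset hL hL'))
      _ = _ := by ring
  -- FKG for `μ₀`
  have hF₀ : (∑ L ∈ C₀.powerset, μ₀ L * x L) * ∑ L ∈ C₀.powerset, μ₀ L * y L ≤
      (∑ L ∈ C₀.powerset, μ₀ L) * ∑ L ∈ C₀.powerset, μ₀ L * (x L * y L) := by
    apply fkg_powerset C₀ μ₀ x y hμ₀0 hx0 hy0 hx hy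
    intro L L' hL hL'
    exact hstep id id L L' hL hL' (hsub L hL) (hsub L' hL') rfl rfl
  -- FKG for `μ'`
  have hF' : (∑ L ∈ C₀.powerset, μ' L * x L) * ∑ L ∈ C₀.powerset, μ' L * y L ≤
      (∑ L ∈ C₀.powerset, μ' L) * ∑ L ∈ C₀.powerset, μ' L * (x L * y L) := by
    apply fkg_powerset C₀ μ' x y hμ'0 hx0 hy0 hx hy
    intro L L' hL hL'
    exact hstep (fun L => insert w (insert u L)) (fun L => insert w (insert u L)) L L' hL hL'
      (hsub' L hL) (hsub' L' hL') (hiww L L') (huww L L')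
  -- Holley `μ₀ → μ₁`
  have h01x : (∑ L ∈ C₀.powerset, μ₀ L * x L) * ∑ L ∈ C₀.powerset, μ₁ L ≤
      (∑ L ∈ C₀.powerset, μ₀ L) * ∑ L ∈ C₀.powerset, μ₁ L * x L := by
    apply holley_powerset C₀ μ₀ μ₁ x hμ₀0 hμ₁0 hx0 hx
    intro L L' hL hL'
    exact hstep id (fun L => insert u L) L L' hL hL' (hsub L hL) (hsub₁ L' hL') (hiu L L' hL)
      (huu L L')
  have h01y : (∑ L ∈ C₀.powerset, μ₀ L * y L) * ∑ L ∈ C₀.powerset, μ₁ L ≤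
      (∑ L ∈ C₀.powerset, μ₀ L) * ∑ L ∈ C₀.powerset, μ₁ L * y L := by
    apply holley_powerset C₀ μ₀ μ₁ y hμ₀0 hμ₁0 hy0 hy
    intro L L' hL hL'
    exact hstep id (fun L => insert u L) L L' hL hL' (hsub L hL) (hsub₁ L' hL') (hiu L L' hL)
      (huu L L')
  -- Holley `μ₁ → μ'`
  have h1'x : (∑ L ∈ C₀.powerset, μ₁ L * x L) * ∑ L ∈ C₀.powerset, μ' L ≤
      (∑ L ∈ C₀.powerset, μ₁ L) * ∑ L ∈ C₀.powerset, μ' L * x L := by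
    apply holley_powerset C₀ μ₁ μ' x hμ₁0 hμ'0 hx0 hx
    intro L L' hL hL'
    exact hstep (fun L => insert u L) (fun L => insert w (insert u L)) L L' hL hL'
      (hsub₁ L hL) (hsub' L' hL') (hi1w L L' hL) (hu1w L L')
  have h1'y : (∑ L ∈ C₀.powerset, μ₁ L * y L) * ∑ L ∈ C₀.powerset, μ' L ≤
      (∑ L ∈ C₀.powerset, μ₁ L) * ∑ L ∈ C₀.powerset, μ' L * y L := by
    apply holley_powerset C₀ μ₁ μ' y hμ₁0 hμ'0 hy0 hy
    intro L L' hL hL'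
    exact hstep (fun L => insert u L) (fun L => insert w (insert u L)) L L' hL hL'
      (hsub₁ L hL) (hsub' L' hL') (hi1w L L' hL) (hu1w L L')
  -- Holley `μ₀ → μ'`
  have h0'x : (∑ L ∈ C₀.powerset, μ₀ L * x L) * ∑ L ∈ C₀.powerset, μ' L ≤
      (∑ L ∈ C₀.powerset, μ₀ L) * ∑ L ∈ C₀.powerset, μ' L * x L := by
    apply holley_powerset C₀ μ₀ μ' x hμ₀0 hμ'0 hx0 hx
    intro L L' hL hL'
    exact hstep id (fun L => insert w (insert u L)) L L' hL hL' (hsub L hL) (hsub' L' hL')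
      (hiuw L L' hL) (huuw L L')
  have h0'y : (∑ L ∈ C₀.powerset, μ₀ L * y L) * ∑ L ∈ C₀.powerset, μ' L ≤
      (∑ L ∈ C₀.powerset, μ₀ L) * ∑ L ∈ C₀.powerset, μ' L * y L := by
    apply holley_powerset C₀ μ₀ μ' y hμ₀0 hμ'0 hy0 hy
    intro L L' hL hL'
    exact hstep id (fun L => insert w (insert u L)) L L' hL hL' (hsub L hL) (hsub' L' hL')
      (hiuw L L' hL) (huuw L L')
  exact star_alg q r _ _ _ _ _ _ _ _ _ _ _ hq hr hM₀ hM' hF₀ hF' h01x h01y h1'x h1'y h0'x h0'y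

end StarLattice

end Summit.Ventures.PercRepro2.Coin
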